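import Summits.BirchSwinnertonDyer.BirchSwinnertonDyer.Theorems.TwoAdicConverseOrdLambdaHalfAtTwoBDPTwoVariableDefs
import Summits.BirchSwinnertonDyer.BirchSwinnertonDyer.Theorems.TwoAdicConverseBDPSelmerLowerDivisibilityAtTwoGaussContent
import HarnessLib

/-!
# Line sketch `greenberg_object_content_two` — crux idea NODE for O2 `BDPSelmerLowerDivisibilityAtTwo`
(stmt-BirchSwinnertonDyer-24728; route TwoAdicConverse; seat 1 GEN 9; lens `complete`@stub(R0G); NOT registered)

The line of record (`Lines/two_variable_gv_squeeze_two.lean`, v7) composes O2 from PRINT (de Shalit II.4.17),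
U, **R0G** = `TwoVariableGreenbergObjectAtTwo`, P2–P5 and ACPIN.  Every card/line filed so far assumed the
Greenberg OBJECT at `2` (R0G: «some `G ∈ 𝒪_{ℂ₂}⟦T₁,T₂⟧` IS `𝓛₂^Gr(E/K)` in the coordinate-free frame») and
attacked the Selmer side; nobody decomposed R0G.  This file is the PROGRAM-COMPLETION node for R0G:

```
R0G  TwoVariableGreenbergObjectAtTwo                                   [v7 stub_greenbergFunctionFree — research]
  ⟸ HIDA₂♭  TwoVariableGreenbergObjectBddAtTwo   — ∃ c, ∃ G ∈ A₂ framing the values SCALED BY 2^c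
  │           (frame with `h_K ↦ 2^c·h_K`): a bounded-denominator two-variable interpolation at 2     [WEAKER]
  ∧ CONTENT₂ TwoVariableGreenbergContentAtTwo     — every such G is divisible by its denominator:
              `2^c ∣ G` in A₂ (= `C (C (2^c)) ∣ G`) (the Λ-adic 2-CONTENT of the Greenberg–Hida measure)         [UNDECIDED]
  glue: `objectAtTwo_of_bdd_of_content` (PROVED below, kernel: `hasValueAt₂_of_C_C_mul` — a value of
        `C(C a)·G'` scaled by `a ≠ 0` is a value of `G'`).
  converse bookkeeping: `bddAtTwo_of_objectAtTwo` (R0G ⟹ HIDA₂♭ with c = 0, PROVED) — so R0G ⟺ HIDA₂♭ ∧ CONTENT₂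
  is NOT claimed (CONTENT₂ quantifies over all c); the node is the implication only.
```
Nothing here proves R0G, O2 or BSD for any curve; typed ≠ proved.  `sorry` occurs only in the two `stub_*`.
-/

set_option linter.dupNamespace false
set_option autoImplicit false

noncomputable section

open scoped Classical NumberField
open WeierstrassCurve NumberField IsDedekindDomain Field PowerSeries CongruenceSubgroup
open Literature.NumberTheory.EllipticCurves Literature.NumberTheory.EllipticCurves.Rank1Residual
open Literature.NumberTheory.EllipticCurves.ModularForms
open Literature.NumberTheory.GaloisRepresentations
open Literature.NumberTheory.EllipticCurves.IwasawaAlgebra₂ Literature.NumberTheory.EllipticCurves.UnrSeries₂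
open Literature.NumberTheory.EllipticCurves.YanZhu2026
open Literature.NumberTheory.EllipticCurves.GreenbergSelmer
open Literature.NumberTheory.EllipticCurves.Castella2018
open Summit.BirchSwinnertonDyer.BirchSwinnertonDyer.Theorems.TwoAdicKatoDeterminant
open Summit.BirchSwinnertonDyer.BirchSwinnertonDyer.Theorems.TwoAdicBDPGaussContent

namespace Summit.BirchSwinnertonDyer.BirchSwinnertonDyer.Cruxes.BDPSelmerLowerDivisibilityAtTwo.GreenbergObjectContentTwo

/-- The coefficient ring of the analytic side at `2`: `𝒪_{ℂ₂}⟦T₁,T₂⟧`. -/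
abbrev A₂ : Type := PowerSeries (PowerSeries (PadicComplexInt 2))

/-! ## §0 Kernel: values of a series scaled by a constant `C (C a)` -/

/-- Coefficients of `C(C a)·G` are `a·`(coefficients of `G`). [folklore] -/
theorem coeff_coeff_C_C_mul (a : PadicComplexInt 2) (G : A₂) (k : ℕ × ℕ) :
    PowerSeries.coeff k.2 (PowerSeries.coeff k.1 (PowerSeries.C (PowerSeries.C a) * G)) =
      a * PowerSeries.coeff k.2 (PowerSeries.coeff k.1 G) := by
  rw [coeff_C_mul, coeff_C_mul]

/-- If `G` has the value `w` at `(x, y)` then `C(C a)·G` has the value `a·w` there. [folklore] -/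
theorem hasValueAt₂_C_C_mul {a : PadicComplexInt 2} {G : A₂} {x y w : ℂ_[2]}
    (h : IntSeries.HasValueAt₂ G x y w) :
    IntSeries.HasValueAt₂ (PowerSeries.C (PowerSeries.C a) * G) x y ((a : ℂ_[2]) * w) := by
  unfold IntSeries.HasValueAt₂ at *
  have key : (fun k : ℕ × ℕ ↦
      ((PowerSeries.coeff k.2 (PowerSeries.coeff k.1 (PowerSeries.C (PowerSeries.C a) * G)) :
        PadicComplexInt 2) : ℂ_[2]) * x ^ k.1 * y ^ k.2) =
      fun k : ℕ × ℕ ↦ (a : ℂ_[2]) *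
        (((PowerSeries.coeff k.2 (PowerSeries.coeff k.1 G) : PadicComplexInt 2) : ℂ_[2]) * x ^ k.1 * y ^ k.2) := by
    funext k
    rw [coeff_coeff_C_C_mul]
    push_cast
    ring
  rw [key]
  exact h.mul_left _

/-- Conversely, for `a ≠ 0`: if `C(C a)·G` has the value `a·w` at `(x, y)` then `G` has the value `w` there
(`ℂ₂` is a field: cancel `a` inside the `HasSum`). [folklore] -/
theorem hasValueAt₂_of_C_C_mul {a : PadicComplexInt 2} (ha : (a : ℂ_[2]) ≠ 0) {G : A₂} {x y w : ℂ_[2]}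
    (h : IntSeries.HasValueAt₂ (PowerSeries.C (PowerSeries.C a) * G) x y ((a : ℂ_[2]) * w)) :
    IntSeries.HasValueAt₂ G x y w := by
  unfold IntSeries.HasValueAt₂ at *
  have key : (fun k : ℕ × ℕ ↦
      ((PowerSeries.coeff k.2 (PowerSeries.coeff k.1 (PowerSeries.C (PowerSeries.C a) * G)) :
        PadicComplexInt 2) : ℂ_[2]) * x ^ k.1 * y ^ k.2) =
      fun k : ℕ × ℕ ↦ (a : ℂ_[2]) *
        (((PowerSeries.coeff k.2 (PowerSeries.coeff k.1 G) : PadicComplexInt 2) : ℂ_[2]) * x ^ k.1 * y ^ k.2) := by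
    funext k
    rw [coeff_coeff_C_C_mul]
    push_cast
    ring
  rw [key] at h
  exact (hasSum_mul_left_iff ha).mp h

/-- The constant `2^c ∈ 𝒪_{ℂ₂}` read in `ℂ₂`. -/
theorem coe_natCast_two_pow (c : ℕ) :
    ((((2 : ℕ) : PadicComplexInt 2) ^ c : PadicComplexInt 2) : ℂ_[2]) = (2 : ℂ_[2]) ^ c := by
  show (PadicComplexInt 2).subtype (((2 : ℕ) : PadicComplexInt 2) ^ c) = (2 : ℂ_[2]) ^ c
  rw [map_pow, map_natCast, Nat.cast_ofNat]

/-- `(2 : 𝒪_{ℂ₂})^c ≠ 0` in `ℂ₂`. -/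
theorem two_pow_coe_ne_zero (c : ℕ) :
    ((((2 : ℕ) : PadicComplexInt 2) ^ c : PadicComplexInt 2) : ℂ_[2]) ≠ 0 := by
  rw [coe_natCast_two_pow]
  exact pow_ne_zero c two_ne_zero

/-! ## §1 The pieces at a datum `(W, K)` — binder for binder v7's `GreenbergObjectAt W K` -/

/-- **R0G at `(E,K)`** — VERBATIM v7 `TwoVariableGvSqueezeTwo.GreenbergObjectAt` (Lines files are not importable):
for every embedding datum, adapted pair and admissible Katz datum `(Ω, δ, Ωp, LK)`, some `G ∈ 𝒪_{ℂ₂}⟦T₁,T₂⟧`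
IS `𝓛_2^Gr(E/K)` in the coordinate-free frame. -/
def GreenbergObjectAt (W : WeierstrassCurve ℚ) [W.IsElliptic] [W.IsGloballyMinimal]
    (K : Type) [Field K] [NumberField K] : Prop :=
  ∀ [IsCMField K] (ι : PadicAlgCl 2 ≃+* ℂ) (v vbar : HeightOneSpectrum (𝓞 K)) (κ₁ κ₂ : ZpExtension K 2)
    (γ₁ γ₂ : absoluteGaloisGroup K) [Fact (ZpExtension.IsTopGeneratorPair κ₁ κ₂ γ₁ γ₂)]
    [NeZero (W.conductorNorm ℤ)] (f : CuspForm (Gamma0 (W.conductorNorm ℤ)) 2),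
    ModularForms.IsNewformOf W f → ∀ [NeZero (NumberField.discr K).natAbs],
    ((2 : ℕ) : 𝓞 K) ∈ v.asIdeal → ((2 : ℕ) : 𝓞 K) ∈ vbar.asIdeal → vbar ≠ v →
    (∀ (w : InfinitePlace K) (k : 𝓞 K), k ∈ v.asIdeal ↔ ‖ι.symm (w.embedding (k : K))‖ < 1) →
    ∀ (Ω δ : ℂ) (Ωp : (unrIntegers 2)ˣ) (LK : A₂),
      Ω ≠ 0 → (δ ^ 2 = (NumberField.discr K : ℂ) ∨ δ ^ 2 = -(NumberField.discr K : ℂ)) →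
      IsKatzMeasure₂ ι v vbar ∅ κ₁ κ₂ γ₁⁻¹ γ₂⁻¹ 1 Ω δ ((Ωp : unrIntegers 2) : ℂ_[2]) LK →
      ∃ G : A₂, IsGreenbergLFunctionFree₂ ι v vbar κ₁ κ₂ γ₁⁻¹ γ₂⁻¹ f (NumberField.discr K).natAbs
        (NumberField.classNumber K) LK G

/-- **HIDA₂♭ at `(E,K)`** — the BOUNDED-DENOMINATOR Greenberg series: same binders, but some `G ∈ A₂` frames the
prescribed values multiplied by `2^c` for some `c : ℕ` (the frame's class-number slot `h_K ↦ 2^c·h_K`), i.e.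
`2^c·𝓛_2^Gr(E/K)` is `2`-integral.  This is what a Hida–Rankin / Katz-type construction of the type-II measure
at `2` would deliver (a measure with bounded denominators); print siblings `p` odd: CGS Thm. 2.4.2, YZ Thm. 3.9. -/
def GreenbergObjectBddAt (W : WeierstrassCurve ℚ) [W.IsElliptic] [W.IsGloballyMinimal]
    (K : Type) [Field K] [NumberField K] : Prop :=
  ∀ [IsCMField K] (ι : PadicAlgCl 2 ≃+* ℂ) (v vbar : HeightOneSpectrum (𝓞 K)) (κ₁ κ₂ : ZpExtension K 2)
    (γ₁ γ₂ : absoluteGaloisGroup K) [Fact (ZpExtension.IsTopGeneratorPair κ₁ κ₂ γ₁ γ₂)]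
    [NeZero (W.conductorNorm ℤ)] (f : CuspForm (Gamma0 (W.conductorNorm ℤ)) 2),
    ModularForms.IsNewformOf W f → ∀ [NeZero (NumberField.discr K).natAbs],
    ((2 : ℕ) : 𝓞 K) ∈ v.asIdeal → ((2 : ℕ) : 𝓞 K) ∈ vbar.asIdeal → vbar ≠ v →
    (∀ (w : InfinitePlace K) (k : 𝓞 K), k ∈ v.asIdeal ↔ ‖ι.symm (w.embedding (k : K))‖ < 1) →
    ∀ (Ω δ : ℂ) (Ωp : (unrIntegers 2)ˣ) (LK : A₂),
      Ω ≠ 0 → (δ ^ 2 = (NumberField.discr K : ℂ) ∨ δ ^ 2 = -(NumberField.discr K : ℂ)) →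
      IsKatzMeasure₂ ι v vbar ∅ κ₁ κ₂ γ₁⁻¹ γ₂⁻¹ 1 Ω δ ((Ωp : unrIntegers 2) : ℂ_[2]) LK →
      ∃ (c : ℕ) (G : A₂), IsGreenbergLFunctionFree₂ ι v vbar κ₁ κ₂ γ₁⁻¹ γ₂⁻¹ f (NumberField.discr K).natAbs
        (2 ^ c * NumberField.classNumber K) LK G

/-- **CONTENT₂ at `(E,K)`** — the Λ-adic `2`-CONTENT of the Greenberg–Hida measure: whenever `G ∈ A₂` frames the
values scaled by `2^c`, the constant `2^c = C(C(2^c))` divides `G` in `A₂ = 𝒪_{ℂ₂}⟦T₁,T₂⟧`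
(coefficientwise: `‖[T₁^iT₂^j]G‖ ≤ |2|^c`, `TwoAdicBDPGaussContent.C_C_dvd_iff_forall_dvd_coeff`).  UNDECIDED; its cheapest falsifier is ONE prescribed value of negative valuation
off the anticyclotomic line (then no integral `G/2^c` exists, by `‖value‖ ≤ 1` for integral series). -/
def GreenbergContentAt (W : WeierstrassCurve ℚ) [W.IsElliptic] [W.IsGloballyMinimal]
    (K : Type) [Field K] [NumberField K] : Prop :=
  ∀ [IsCMField K] (ι : PadicAlgCl 2 ≃+* ℂ) (v vbar : HeightOneSpectrum (𝓞 K)) (κ₁ κ₂ : ZpExtension K 2)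
    (γ₁ γ₂ : absoluteGaloisGroup K) [Fact (ZpExtension.IsTopGeneratorPair κ₁ κ₂ γ₁ γ₂)]
    [NeZero (W.conductorNorm ℤ)] (f : CuspForm (Gamma0 (W.conductorNorm ℤ)) 2),
    ModularForms.IsNewformOf W f → ∀ [NeZero (NumberField.discr K).natAbs],
    ((2 : ℕ) : 𝓞 K) ∈ v.asIdeal → ((2 : ℕ) : 𝓞 K) ∈ vbar.asIdeal → vbar ≠ v →
    (∀ (w : InfinitePlace K) (k : 𝓞 K), k ∈ v.asIdeal ↔ ‖ι.symm (w.embedding (k : K))‖ < 1) →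
    ∀ (Ω δ : ℂ) (Ωp : (unrIntegers 2)ˣ) (LK : A₂),
      Ω ≠ 0 → (δ ^ 2 = (NumberField.discr K : ℂ) ∨ δ ^ 2 = -(NumberField.discr K : ℂ)) →
      IsKatzMeasure₂ ι v vbar ∅ κ₁ κ₂ γ₁⁻¹ γ₂⁻¹ 1 Ω δ ((Ωp : unrIntegers 2) : ℂ_[2]) LK →
      ∀ (c : ℕ) (G : A₂), IsGreenbergLFunctionFree₂ ι v vbar κ₁ κ₂ γ₁⁻¹ γ₂⁻¹ f (NumberField.discr K).natAbs
        (2 ^ c * NumberField.classNumber K) LK G →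
        ((2 : ℕ) : A₂) ^ c ∣ G

/-! ## §2 The glue at a datum: HIDA₂♭ ∧ CONTENT₂ ⟹ R0G (and R0G ⟹ HIDA₂♭) -/

/-- **Frame descaling**: if `C(C(2^c))·G'` frames the values scaled by `2^c·h_K` then `G'` frames the values scaled
by `h_K`. [folklore; the frame `IsGreenbergLFunctionFree₂` unfolded at each character] -/
theorem isGreenbergLFunctionFree₂_of_C_C_mul {K : Type} [Field K] [NumberField K] [IsCMField K]
    {ι : PadicAlgCl 2 ≃+* ℂ} {v vbar : HeightOneSpectrum (𝓞 K)} {κ₁ κ₂ : ZpExtension K 2}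
    {g₁ g₂ : absoluteGaloisGroup K} {N : ℕ} {f : CuspForm (Gamma0 N) 2} {D : ℕ} [NeZero D] {hK c : ℕ}
    {LK G' : A₂}
    (h : IsGreenbergLFunctionFree₂ ι v vbar κ₁ κ₂ g₁ g₂ f D (2 ^ c * hK) LK
      (PowerSeries.C (PowerSeries.C (((2 : ℕ) : PadicComplexInt 2) ^ c)) * G')) :
    IsGreenbergLFunctionFree₂ ι v vbar κ₁ κ₂ g₁ g₂ f D hK LK G' := by
  intro ξ r r' m n α hr hκ hr' hunr hinf hα θ hθ L hL hL' y hy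
  have hv := h ξ r r' m n α hr hκ hr' hunr hinf hα θ hθ L hL hL' y hy
  refine hasValueAt₂_of_C_C_mul (two_pow_coe_ne_zero c) ?_
  convert hv using 1
  rw [coe_natCast_two_pow]
  push_cast
  ring

/-- **HIDA₂♭ ∧ CONTENT₂ ⟹ R0G at a datum.** -/
theorem objectAt_of_bdd_of_content (W : WeierstrassCurve ℚ) [W.IsElliptic] [W.IsGloballyMinimal]
    (K : Type) [Field K] [NumberField K] (hB : GreenbergObjectBddAt W K) (hC : GreenbergContentAt W K) :
    GreenbergObjectAt W K := by
  intro _ ι v vbar κ₁ κ₂ γ₁ γ₂ _ _ f hf _ hv hvbar hne hι Ω δ Ωp LK hΩ hδ hLK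
  obtain ⟨c, G, hG⟩ := hB ι v vbar κ₁ κ₂ γ₁ γ₂ f hf hv hvbar hne hι Ω δ Ωp LK hΩ hδ hLK
  obtain ⟨G', rfl⟩ := hC ι v vbar κ₁ κ₂ γ₁ γ₂ f hf hv hvbar hne hι Ω δ Ωp LK hΩ hδ hLK c G hG
  rw [natCast_pow_eq_C_C] at hG
  exact ⟨G', isGreenbergLFunctionFree₂_of_C_C_mul hG⟩

/-- **R0G ⟹ HIDA₂♭ at a datum** (`c = 0`): bookkeeping converse of the first piece. -/
theorem bdd_of_objectAt (W : WeierstrassCurve ℚ) [W.IsElliptic] [W.IsGloballyMinimal]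
    (K : Type) [Field K] [NumberField K] (hO : GreenbergObjectAt W K) : GreenbergObjectBddAt W K := by
  intro _ ι v vbar κ₁ κ₂ γ₁ γ₂ _ _ f hf _ hv hvbar hne hι Ω δ Ωp LK hΩ hδ hLK
  obtain ⟨G, hG⟩ := hO ι v vbar κ₁ κ₂ γ₁ γ₂ f hf hv hvbar hne hι Ω δ Ωp LK hΩ hδ hLK
  exact ⟨0, G, by simpa only [pow_zero, one_mul] using hG⟩

/-! ## §3 Habitat wrappers (β) and the node's composition -/

/-- R0G on the habitat (β) — VERBATIM v7 `TwoVariableGreenbergObjectAtTwo` (= `stub_greenbergFunctionFree`). -/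
def TwoVariableGreenbergObjectAtTwo : Prop :=
  ∀ (W : WeierstrassCurve ℚ) [W.IsElliptic] [W.IsGloballyMinimal],
    ¬ W.HasCM → GoodOrd W 2 → ¬ W.HasIrreducibleModPGaloisRep 2 →
    ∀ (K : Type) [Field K] [NumberField K],
      (IsImaginaryQuadratic K ∧ SatisfiesHeegnerHypothesis (2 * W.conductorNorm ℤ) K) →
      GreenbergObjectAt W K

/-- HIDA₂♭ on the habitat (β): bounded-denominator two-variable Greenberg series at `2`.  Research, print-adjacent
(Hida–Rankin measure / Katz–BDP toric construction at `p = 2`). -/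
def TwoVariableGreenbergObjectBddAtTwo : Prop :=
  ∀ (W : WeierstrassCurve ℚ) [W.IsElliptic] [W.IsGloballyMinimal],
    ¬ W.HasCM → GoodOrd W 2 → ¬ W.HasIrreducibleModPGaloisRep 2 →
    ∀ (K : Type) [Field K] [NumberField K],
      (IsImaginaryQuadratic K ∧ SatisfiesHeegnerHypothesis (2 * W.conductorNorm ℤ) K) →
      GreenbergObjectBddAt W K

/-- CONTENT₂ on the habitat (β): the Λ-adic `2`-content of the Greenberg–Hida measure.  UNDECIDED; instrumentable
(off-line `2`-adic drift of the prescribed values). -/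
def TwoVariableGreenbergContentAtTwo : Prop :=
  ∀ (W : WeierstrassCurve ℚ) [W.IsElliptic] [W.IsGloballyMinimal],
    ¬ W.HasCM → GoodOrd W 2 → ¬ W.HasIrreducibleModPGaloisRep 2 →
    ∀ (K : Type) [Field K] [NumberField K],
      (IsImaginaryQuadratic K ∧ SatisfiesHeegnerHypothesis (2 * W.conductorNorm ℤ) K) →
      GreenbergContentAt W K

/-- Stub (research, print-adjacent): HIDA₂♭. -/
theorem stub_greenbergObjectBdd : TwoVariableGreenbergObjectBddAtTwo := by
  sorry

/-- Stub (UNDECIDED, instrumentable): CONTENT₂. -/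
theorem stub_greenbergContent : TwoVariableGreenbergContentAtTwo := by
  sorry

/-- **THE NODE: HIDA₂♭ → CONTENT₂ → R0G on the habitat** (sorry-free composition; a typed RESPLIT of v7's
`stub_greenbergFunctionFree`). -/
theorem objectAtTwo_of_bdd_of_content :
    TwoVariableGreenbergObjectBddAtTwo → TwoVariableGreenbergContentAtTwo → TwoVariableGreenbergObjectAtTwo :=
  fun hB hC W _ _ hCM hGO hβ K _ _ hK =>
    objectAt_of_bdd_of_content W K (hB W hCM hGO hβ K hK) (hC W hCM hGO hβ K hK)

/-- Bookkeeping converse on the habitat: R0G → HIDA₂♭. -/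
theorem bddAtTwo_of_objectAtTwo : TwoVariableGreenbergObjectAtTwo → TwoVariableGreenbergObjectBddAtTwo :=
  fun hO W _ _ hCM hGO hβ K _ _ hK => bdd_of_objectAt W K (hO W hCM hGO hβ K hK)

/-- R0G from the two stubs (what v7's `stub_greenbergFunctionFree` becomes under this resplit). -/
theorem greenbergFunctionFree_of_stubs : TwoVariableGreenbergObjectAtTwo :=
  objectAtTwo_of_bdd_of_content stub_greenbergObjectBdd stub_greenbergContent


end Summit.BirchSwinnertonDyer.BirchSwinnertonDyer.Cruxes.BDPSelmerLowerDivisibilityAtTwo.GreenbergObjectContentTwo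

end
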